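import Summits.HodgeConjecture.CorCM.CMWeightPullbackSubproduct
import Summits.HodgeConjecture.CorCM.CMWeightLinesDisjointUnion
import Summits.HodgeConjecture.CorCM.AndreRiemannBiproducts
import Literature.AlgebraicGeometry.HodgeTheory.WeilClassesDescendingTransfer
import Literature.AlgebraicGeometry.HodgeTheory.ComplexOrientationFamily
import HarnessLib

/-!
# Weights of a CM product: algebraicity of a weight line DESCENDS to a coordinate sub-product by push-forward
# (projection formula along the projection `π_e : ⨁_i B_i → ⨁_j B_{e j}`)

COR-CM (cell `pub-hodgecm2`), seat b30 gen 21 (2026-08-22); count-neutral own lane (the «PUSH-FORWARD infrastructure» asked for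
by the gen-20 census of two `(1,3)`-types, `Census/OcticWeilMixed`); theorems only, no definition, no named fact, no `sorry`.
HONEST FRAMING: structure lemmas about products of CM abelian varieties; no case of the Hodge conjecture is proved here and
`HC_CM` is never asserted.

SETTING.  Realisations `(B_i, ι_i, θ_i)_{i<n}` of CM types `Φ_i` of number fields `K_i` read on `H¹` (`IsCMTypeRealisation`),
`X = ⨁_i B_i`, an INJECTIVE re-indexing `e : Fin m → Fin n` and the coordinate sub-product `X' = ⨁_j B_{e j}` with its projection
`π_e = biproduct.lift (π_{e j}) : X ⟶ X'` (`CorCM/CMWeightPullbackSubproduct`).  Weights of `X` are finite subsets of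
`⊔_i Hom(K_i, ℂ)`; `σ_e (j, s) = (e j, s)` embeds the weights of `X'`.

THE POINT OF THE FILE (`weightClassesAlg_le_algebraicClasses_of_pushforward`).  Let `S` be a weight of `X'` (`|S| = 2p`) and
let `T`, `T'` be DISJOINT weights of `X` which together are EXACTLY the coordinates of the factors off `range e`
(`|T| = 2q`, `|T'| = 2r`).  IF the weight line of `σ_e S ⊔ T` on `X` and the weight line of `T'` on `X` consist of algebraic
classes, THEN the weight line of `S` on `X'` consists of algebraic classes.  This is the push-forward twin of the pull-back
lemma `CMWeights.weightClassesAlg_map_le_algebraicClasses` (algebraicity ASCENDS along `π_e^*`) and of the distribution lemma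
`CMWeights.weightClassesAlg_comp_le_algebraicClasses_of_injOn`; it converts a census that is clean only RATIONALLY (a balanced
weight `S` which becomes a disjoint union of generating parts after fresh coordinates `T` are adjoined, the complementary
weight `T'` being generated too) into algebraicity of `S` itself.  First consumer: the eightfold Weil weight
`{(a,+)_{B'₁}} ⊔ {(a,−)_{B'₂}}` of two `(1,3)`-types over one octic CM field (`CorCM/OcticWeil13PairEightfoldParts`).

PROOF (Schoen's transfer, *Compositio* 114 (1998) §10, run along `π_e` instead of a product projection; on the carriers the
pattern of the tree's `mem_algebraicClasses_of_complexGysin_fst_cupProduct`).  Let `c` generate the line of `S` on `X'`, `u`, `η`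
the lines of `T`, `T'` on `X`.  Then `z = π_e^* c ∪ (u ∪ η)` lies in the line of `σ_e S ⊔ T ⊔ T'`, which is `(line of σ_e S ⊔ T)
∪ (line of T')`, hence is algebraic (cup products of algebraic classes on an abelian variety, `cupProduct_mem_algebraicClasses'`);
its Gysin image `π_{e*} z` is algebraic (`complexGysin_mem_algebraicClasses`) and equals `c ∪ π_{e*}(u ∪ η)` (projection formula
`complexGysin_cup`) `= ε • c` (`H⁰(X'(ℂ); ℂ) = ℂ · 1`, `exists_eq_smul_one`); finally `ε ≠ 0`: for the top weight class `t'` of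
`X'` the class `π_e^* t' ∪ (u ∪ η)` is a NON-ZERO top class of `X` (the cup product of non-zero weight classes of disjoint
weights is non-zero: it is a multiple of a monomial basis vector, `cupProduct_ne_zero_of_mem_weightClassesAlg`), its Gysin
image is `ε • t'`, and Gysin maps are injective in the top degree (`complexGysin_apply_top_ne_zero`: cap product with the
fundamental classes and `H₀` of a path-connected space).

## Contents
* §1 `cupProduct_mem_weightClassesAlg`, `cupProduct_ne_zero_of_mem_weightClassesAlg` — weight classes multiply into the
  weight space of the union; non-zero classes of disjoint weights have non-zero product (realisation families);
* §2 `complexGysin_apply_top_ne_zero` — `f_*` is injective on the top degree of a smooth projective source;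
* §3 `card_univ_sigma_eq_two_mul_dim` — `|⊔_i Hom(K_i, ℂ)| = 2 dim ⨁_i B_i`;
* §4 `weightClassesAlg_le_algebraicClasses_of_pushforward` (THE LEMMA) and `…_map_le_algebraicClasses_of_pushforward` (the
  same line read on `X` through `π_e^*`).

## References
* [Schoen1998HodgeWeilAddendum] C. Schoen, *Addendum to: Hodge classes on self-products of a variety with an automorphism*,
  Compositio Math. 114 (1998), §10 (the transfer `pr_{A*}(z · (A × D))`).
* [FultonYoungTableaux1997] W. Fulton, *Young Tableaux*, App. B §B.1 (5)–(7) (Gysin maps, projection formula).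
* [Milne2020HodgeClassesAV] J. S. Milne, *Hodge classes on abelian varieties*, arXiv:2010.08857, 1.2 (a).
* [HatcherAT2002] A. Hatcher, *Algebraic Topology*, §3.2 (cup products), §3.3 Thm. 3.26, Thm. 3.30.
-/

noncomputable section

open CategoryTheory CategoryTheory.Limits NumberField

namespace Summit.HodgeConjecture.CorCM.CMWeights

open Literature.AlgebraicGeometry Literature.AlgebraicGeometry.Motives Literature.AlgebraicGeometry.HodgeTheory
open Literature.AlgebraicGeometry.ComplexMultiplication (IsCMTypeRealisation)
open Literature.AlgebraicGeometry.Pohlmann1968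
open Literature.AlgebraicTopology.SingularHomology
open Summit.HodgeConjecture.CorCM.PairWeights (cupMonomial_eq_smul_cupProduct_of_eq_disjUnion)

open scoped Classical

variable {m n : ℕ} {K : Fin n → Type} [∀ i, Field (K i)] [∀ i, NumberField (K i)]
variable {A : Fin n → AbelianVariety ℂ} {Φ : ∀ i, CMType (K i)} {ι : ∀ i, 𝓞 (K i) →+* End (A i)}
  {θ : ∀ i, K i →+* Module.End ℂ (complexBetti (A i).X 1)}

/-! ### §1 Weight classes multiply; non-zero classes of disjoint weights have a non-zero product -/

omit [∀ i, NumberField (K i)] in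
/-- **Weight classes multiply into the weight space of the union**: if `(⊕ ι_i(a_i))^*` acts on `c` by the character of `S`
and on `c'` by the character of `S'`, `S ∩ S' = ∅`, then it acts on `c ∪ c'` by the character of `S ∪ S'` (pull-backs are
multiplicative, `cupProduct_map`; `∏_{S ⊔ S'} = ∏_S · ∏_{S'}`). [cite: Milne2020HodgeClassesAV, 1.2 (a)]
[cite: HatcherAT2002, §3.2 Prop. 3.10] -/
theorem cupProduct_mem_weightClassesAlg {k k' d : ℕ} (h : k + k' = d) {S S' : Finset ((i : Fin n) × (K i →+* ℂ))}
    (hSS' : Disjoint S S') {c : complexBetti (⨁ A).X k} {c' : complexBetti (⨁ A).X k'}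
    (hc : c ∈ weightClassesAlg A ι k S) (hc' : c' ∈ weightClassesAlg A ι k' S') :
    cupProduct h c c' ∈ weightClassesAlg A ι d (S ∪ S') := by
  rw [mem_weightClassesAlg_iff] at hc hc' ⊢
  intro a
  have hmap : complexBetti.map (biproduct.map fun i => ι i (a i)).hom.hom.hom d (cupProduct h c c') =
      cupProduct h (complexBetti.map (biproduct.map fun i => ι i (a i)).hom.hom.hom k c)
        (complexBetti.map (biproduct.map fun i => ι i (a i)).hom.hom.hom k' c') :=
    cupProduct_map _ h c c'
  rw [hmap, hc a, hc' a, LinearMap.map_smul₂, map_smul, smul_smul, Finset.prod_union hSS']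

/-- **Non-zero weight classes of DISJOINT weights have a non-zero cup product** (realisation families): each weight space is
the line of the cup monomial of its weight on an eigenbasis of `H¹(⨁ A)` (`weightClassesAlg_eq_span_singleton`), and
`w_S ∪ w_{S'} = ± w_{S ⊔ S'}` is a basis vector of `H^{|S|+|S'|}` (`cupMonomial_disjUnion_eq_smul_cup`, `exists_monomialBasis`).
[cite: Milne2020HodgeClassesAV, 1.2 (a)] [cite: HatcherAT2002, §3.2 Example 3.16] -/
theorem cupProduct_ne_zero_of_mem_weightClassesAlg (hA : ∀ i, IsCMTypeRealisation (Φ i) (A i) (ι i) (θ i))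
    {a b d : ℕ} (h : a + b = d) {S S' : Finset ((i : Fin n) × (K i →+* ℂ))} (hS : S.card = a) (hS' : S'.card = b)
    (hSS' : Disjoint S S') {c : complexBetti (⨁ A).X a} {c' : complexBetti (⨁ A).X b}
    (hc : c ∈ weightClassesAlg A ι a S) (hc' : c' ∈ weightClassesAlg A ι b S') (hc0 : c ≠ 0) (hc'0 : c' ≠ 0) :
    cupProduct h c c' ≠ 0 := by
  subst h
  letI : LinearOrder ((i : Fin n) × (K i →+* ℂ)) :=
    LinearOrder.lift' (Fintype.equivFin _) (Fintype.equivFin _).injective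
  obtain ⟨w, hw, -, -⟩ := exists_eigenbasis_biproduct hA
  obtain ⟨bS, hbS'⟩ := exists_monomialBasis w a
  obtain ⟨bT, hbT'⟩ := exists_monomialBasis w b
  obtain ⟨bU, hbU'⟩ := exists_monomialBasis w (a + b)
  have hbS : ∀ s, bS s = cupMonomial w a s := hbS'
  have hbT : ∀ s, bT s = cupMonomial w b s := hbT'
  have hbU : ∀ s, bU s = cupMonomial w (a + b) s := hbU'
  have hU : (S.disjUnion S' hSS').card = a + b := by rw [Finset.card_disjUnion, hS, hS']
  set uS : Set.powersetCard ((i : Fin n) × (K i →+* ℂ)) a := Set.powersetCard.ofCard hS with huS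
  set uT : Set.powersetCard ((i : Fin n) × (K i →+* ℂ)) b := Set.powersetCard.ofCard hS' with huT
  set uU : Set.powersetCard ((i : Fin n) × (K i →+* ℂ)) (a + b) := Set.powersetCard.ofCard hU with huU
  -- the two classes are multiples of the monomials
  have hlineS : weightClassesAlg A ι a S = ℂ ∙ bS uS := weightClassesAlg_eq_span_singleton hw hbS uS
  have hlineT : weightClassesAlg A ι b S' = ℂ ∙ bT uT := weightClassesAlg_eq_span_singleton hw hbT uT
  rw [hlineS] at hc
  rw [hlineT] at hc'
  obtain ⟨t, ht⟩ := Submodule.mem_span_singleton.1 hc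
  obtain ⟨t', ht'⟩ := Submodule.mem_span_singleton.1 hc'
  have ht0 : t ≠ 0 := by rintro rfl; exact hc0 (by rw [← ht, zero_smul])
  have ht'0 : t' ≠ 0 := by rintro rfl; exact hc'0 (by rw [← ht', zero_smul])
  -- `w_S ∪ w_{S'} = ± w_{S ⊔ S'} ≠ 0`
  obtain ⟨ε, hε⟩ := cupMonomial_eq_smul_cupProduct_of_eq_disjUnion w rfl uS uT hSS' uU rfl
  have hmono : cupProduct rfl (bS uS) (bT uT) ≠ 0 := by
    intro h0
    apply bU.ne_zero uU
    rw [hbU uU, hε, ← hbS uS, ← hbT uT, h0, smul_zero]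
  rw [← ht, ← ht', LinearMap.map_smul₂, map_smul, smul_smul]
  exact smul_ne_zero (mul_ne_zero ht0 ht'0) hmono

/-! ### §2 Gysin maps are injective on the top degree of the source -/

section Gysin

variable {l l' : ℕ} {Y X : SchemeOver ℂ}

/-- `Y(ℂ)` is path connected for `Y` smooth projective (connected, `connectedSpace_complexPoints`, and locally path connected
as a topological manifold). [cite: HatcherAT2002, §3.3 (closed manifolds)] -/
private theorem pathConnectedSpace_complexPoints' (hY : IsSmoothProjective l Y) : PathConnectedSpace (ComplexPoints Y) := by
  haveI := connectedSpace_complexPoints hY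
  letI := hY.chartedSpace
  haveI : LocallyPathConnectedSpace (ComplexPoints Y) :=
    ChartedSpace.locallyPathConnectedSpace (H := EuclideanSpace ℝ (Fin (2 * l))) (M := ComplexPoints Y)
  exact pathConnectedSpace_iff_connectedSpace.2 inferInstance

/-- **`f_*` is injective on the top degree** `H^{2 dim Y}(Y(ℂ); ℂ)` of a smooth projective source, for every morphism
`f : Y ⟶ X` of smooth projective varieties and every orientation family: `f_* y ⌢ [X] = f(ℂ)_*(y ⌢ [Y])`
(`capProduct_complexGysin`), `⌢ [Y]` is injective (Poincaré duality, `OrientationFamily.hasPoincareDuality`) and `f(ℂ)_*` is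
injective on `H₀` of the path-connected `Y(ℂ)` (the augmentation is a natural isomorphism there).
[cite: FultonYoungTableaux1997, Appendix B §B.1 (5)] [cite: HatcherAT2002, §3.3 Thm. 3.30 and §2.1 Prop. 2.7] -/
theorem complexGysin_apply_top_ne_zero (μ : OrientationFamily) (hY : IsSmoothProjective l Y)
    (hX : IsSmoothProjective l' X) (f : Y ⟶ X) {a b : ℕ} (hab : a + 2 * l' = b + 2 * l) (ha : a = 2 * l)
    {y : complexBetti Y a} (hy : y ≠ 0) : complexGysin μ hY hX f hab y ≠ 0 := by
  subst ha
  have hμ : μ.HasPoincareDuality := OrientationFamily.hasPoincareDuality μ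
  have hb : b + 0 = 2 * l' := by omega
  intro h0
  have hcap := capProduct_complexGysin hμ hY hX f hab (Nat.add_zero _) hb y
  rw [h0, LinearMap.map_zero₂] at hcap
  haveI := pathConnectedSpace_complexPoints' hY
  haveI := singularHomology.isIso_ε_of_pathConnectedSpace ℂ ℂ (X := ComplexPoints Y)
  have hinj : Function.Injective (singularHomology.map ℂ ℂ (AlgPoints.mapContinuous (L := ℂ) f) 0) := by
    intro a' b' hab'
    have h := singularHomology.map_ε (R := ℂ) (M := ℂ) (X := ComplexPoints Y) (AlgPoints.mapContinuous (L := ℂ) f)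
    have ha' : singularHomology.ε ℂ ℂ (ComplexPoints Y) a' = singularHomology.ε ℂ ℂ (ComplexPoints Y) b' := by
      rw [← h, ModuleCat.comp_apply, ModuleCat.comp_apply, hab']
    exact (ModuleCat.mono_iff_injective (singularHomology.ε ℂ ℂ (ComplexPoints Y))).1 inferInstance ha'
  have hzero : capProduct (Nat.add_zero _) y (μ hY).fundamentalClass = 0 := hinj (by rw [← hcap, map_zero])
  refine hy ((hμ hY (Nat.add_zero _)).1 ?_)
  rw [poincareDualityMap_apply, hzero, poincareDualityMap_apply, LinearMap.map_zero₂]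

end Gysin

/-! ### §3 Counting coordinates -/

/-- `|⊔_i Hom(K_i, ℂ)| = Σ_i [K_i : ℚ] = 2 dim ⨁_i A_i` for a realisation family (`[K_i : ℚ] = dim_ℂ H¹(A_i) = 2 dim A_i`).
[cite: Milne2020HodgeClassesAV, 1.1] -/
theorem card_univ_sigma_eq_two_mul_dim (hA : ∀ i, IsCMTypeRealisation (Φ i) (A i) (ι i) (θ i)) :
    Fintype.card ((i : Fin n) × (K i →+* ℂ)) = 2 * (⨁ A).dim := by
  rw [Fintype.card_sigma, AndreRiemann.dim_biproduct_fin, Finset.mul_sum]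
  refine Finset.sum_congr rfl fun i _ => ?_
  rw [NumberField.Embeddings.card, ← (hA i).2.1, AbelianVariety.finrank_complexBetti_one]

/-! ### §4 The push-forward extraction lemma -/

/-- **Algebraicity of a weight line DESCENDS to a coordinate sub-product along the Gysin map of the projection.**  Let
`(A_i, ι_i, θ_i)_{i<n}` be realisations of CM types, `e : Fin m → Fin n` injective, `X = ⨁_i A_i`, `X' = ⨁_j A_{e j}`, `S` a
weight of `X'` with `|S| = 2p`, and `T`, `T'` disjoint weights of `X` with `|T| = 2q`, `|T'| = 2r` and `T ⊔ T' =` the set of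
ALL coordinates `(i, s)` with `i ∉ range e`.  If the weight line of `σ_e S ⊔ T` on `X` lies in `N^{p+q}` and the weight line
of `T'` on `X` lies in `Nʳ`, then the weight line of `S` on `X'` lies in `Nᵖ H^{2p}(X'(ℂ); ℂ)`.  Proof in the module
docstring (projection formula along `π_e`, `H⁰ = ℂ · 1`, injectivity of `π_{e*}` on the top degree).
[cite: Schoen1998HodgeWeilAddendum, §10 (proof of the Proposition)] [cite: FultonYoungTableaux1997, Appendix B §B.1 (5)–(7)]
[cite: Milne2020HodgeClassesAV, 1.2 (a)] -/
theorem weightClassesAlg_le_algebraicClasses_of_pushforward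
    (hA : ∀ i, IsCMTypeRealisation (Φ i) (A i) (ι i) (θ i)) (e : Fin m → Fin n) (he : Function.Injective e)
    {p q r : ℕ} {S : Finset ((j : Fin m) × (K (e j) →+* ℂ))} (hS : S.card = 2 * p)
    {T T' : Finset ((i : Fin n) × (K i →+* ℂ))} (hT : T.card = 2 * q) (hT' : T'.card = 2 * r)
    (hTT' : Disjoint T T') (hcov : ∀ x : (i : Fin n) × (K i →+* ℂ), (x ∈ T ∨ x ∈ T') ↔ x.1 ∉ Set.range e)
    (halg₁ : weightClassesAlg A ι (2 * (p + q)) (S.map ⟨_, sigma_map_injective e he⟩ ∪ T) ≤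
      algebraicClasses (⨁ A).X (p + q))
    (halg₂ : weightClassesAlg A ι (2 * r) T' ≤ algebraicClasses (⨁ A).X r) :
    weightClassesAlg (fun j => A (e j)) (fun j => ι (e j)) (2 * p) S ≤
      algebraicClasses (⨁ fun j => A (e j)).X p := by
  have hA' : ∀ j, IsCMTypeRealisation (Φ (e j)) (A (e j)) (ι (e j)) (θ (e j)) := fun j => hA (e j)
  set π : (⨁ A) ⟶ ⨁ (fun j => A (e j)) := biproduct.lift (fun j => biproduct.π A (e j)) with hπ
  set σ : ((j : Fin m) × (K (e j) →+* ℂ)) ↪ ((i : Fin n) × (K i →+* ℂ)) := ⟨_, sigma_map_injective e he⟩ with hσ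
  have hX : IsSmoothProjective (⨁ A).dim (⨁ A).X := AbelianVariety.isSmoothProjective_holds
  have hX' : IsSmoothProjective (⨁ fun j => A (e j)).dim (⨁ fun j => A (e j)).X :=
    AbelianVariety.isSmoothProjective_holds
  set M := (⨁ A).dim with hM
  set M' := (⨁ fun j => A (e j)).dim with hM'
  -- ## counting: `|U| = 2M'`, `|U| + |T| + |T'| = 2M` for `U` = the coordinates of the kept slots
  have hcardX : Fintype.card ((i : Fin n) × (K i →+* ℂ)) = 2 * M := card_univ_sigma_eq_two_mul_dim hA
  have hcardX' : Fintype.card ((j : Fin m) × (K (e j) →+* ℂ)) = 2 * M' :=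
    card_univ_sigma_eq_two_mul_dim (A := fun j => A (e j)) (Φ := fun j => Φ (e j)) (ι := fun j => ι (e j))
      (θ := fun j => θ (e j)) hA'
  set U : Finset ((i : Fin n) × (K i →+* ℂ)) := Finset.univ.map σ with hU
  have hUcard : U.card = 2 * M' := by rw [hU, Finset.card_map, Finset.card_univ, hcardX']
  have hmemU : ∀ x : (i : Fin n) × (K i →+* ℂ), x ∈ U ↔ x.1 ∈ Set.range e := by
    intro x
    constructor
    · intro hx
      obtain ⟨y, -, rfl⟩ := Finset.mem_map.1 hx
      exact ⟨y.1, rfl⟩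
    · rintro ⟨j, hj⟩
      obtain ⟨i, s⟩ := x
      dsimp only at hj
      subst hj
      exact Finset.mem_map.2 ⟨⟨j, s⟩, Finset.mem_univ _, rfl⟩
  have hUT : Disjoint U T :=
    Finset.disjoint_left.2 fun x hxU hxT => ((hcov x).1 (Or.inl hxT)) ((hmemU x).1 hxU)
  have hUT' : Disjoint U T' :=
    Finset.disjoint_left.2 fun x hxU hxT => ((hcov x).1 (Or.inr hxT)) ((hmemU x).1 hxU)
  have hUTT' : Disjoint U (T ∪ T') := Finset.disjoint_union_right.2 ⟨hUT, hUT'⟩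
  have hunion : U ∪ (T ∪ T') = Finset.univ := by
    ext x
    simp only [Finset.mem_union, Finset.mem_univ, iff_true]
    by_cases hx : x.1 ∈ Set.range e
    · exact Or.inl ((hmemU x).2 hx)
    · exact Or.inr ((hcov x).2 hx)
  have hTT'card : (T ∪ T').card = 2 * q + 2 * r := by rw [Finset.card_union_of_disjoint hTT', hT, hT']
  have hdim : 2 * M' + (2 * q + 2 * r) = 2 * M := by
    have h := Finset.card_union_of_disjoint hUTT'
    rw [hunion, Finset.card_univ, hcardX, hUcard, hTT'card] at h
    omega
  have hST : Disjoint (S.map σ) T :=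
    Finset.disjoint_of_subset_left (Finset.map_subset_map.2 (Finset.subset_univ S)) hUT
  -- ## generators of the four lines
  obtain ⟨c, hc0, hlinec⟩ := exists_weightClassesAlg_eq_span_singleton (A := fun j => A (e j))
    (Φ := fun j => Φ (e j)) (ι := fun j => ι (e j)) (θ := fun j => θ (e j)) hA' hS
  have huniv' : (Finset.univ : Finset ((j : Fin m) × (K (e j) →+* ℂ))).card = 2 * M' := by
    rw [Finset.card_univ, hcardX']
  obtain ⟨t, ht0, hlinet⟩ := exists_weightClassesAlg_eq_span_singleton (A := fun j => A (e j))
    (Φ := fun j => Φ (e j)) (ι := fun j => ι (e j)) (θ := fun j => θ (e j)) hA' huniv'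
  obtain ⟨u, hu0, hlineu⟩ := exists_weightClassesAlg_eq_span_singleton hA hT
  obtain ⟨η, hη0, hlineη⟩ := exists_weightClassesAlg_eq_span_singleton hA hT'
  have hcmem : c ∈ weightClassesAlg (fun j => A (e j)) (fun j => ι (e j)) (2 * p) S := by
    rw [hlinec]; exact Submodule.mem_span_singleton_self _
  have htmem : t ∈ weightClassesAlg (fun j => A (e j)) (fun j => ι (e j)) (2 * M') Finset.univ := by
    rw [hlinet]; exact Submodule.mem_span_singleton_self _
  have humem : u ∈ weightClassesAlg A ι (2 * q) T := by rw [hlineu]; exact Submodule.mem_span_singleton_self _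
  have hηmem : η ∈ weightClassesAlg A ι (2 * r) T' := by rw [hlineη]; exact Submodule.mem_span_singleton_self _
  -- pulled back to `X`
  have hpc : complexBetti.map π.hom.hom.hom (2 * p) c ∈ weightClassesAlg A ι (2 * p) (S.map σ) :=
    map_mem_weightClassesAlg_of_mem e he hcmem
  have hpt : complexBetti.map π.hom.hom.hom (2 * M') t ∈ weightClassesAlg A ι (2 * M') U :=
    map_mem_weightClassesAlg_of_mem e he htmem
  have hpt0 : complexBetti.map π.hom.hom.hom (2 * M') t ≠ 0 := fun h =>
    ht0 (complexBetti_map_lift_π_injective e he (2 * M') (by rw [h, map_zero]))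
  -- `y = u ∪ η`: the line of `T ⊔ T'`, non-zero
  set y : complexBetti (⨁ A).X (2 * q + 2 * r) := cupProduct rfl u η with hy
  have hymem : y ∈ weightClassesAlg A ι (2 * q + 2 * r) (T ∪ T') := cupProduct_mem_weightClassesAlg rfl hTT' humem hηmem
  have hy0 : y ≠ 0 := cupProduct_ne_zero_of_mem_weightClassesAlg hA rfl hT hT' hTT' humem hηmem hu0 hη0
  -- ## `z = (π^* c ∪ u) ∪ η` is algebraic on `X`
  have h₁ : 2 * p + 2 * q = 2 * (p + q) := by ring
  have h₂ : 2 * (p + q) + 2 * r = 2 * (p + q + r) := by ring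
  have hk : 2 * p + (2 * q + 2 * r) = 2 * (p + q + r) := by ring
  have hz₁ : cupProduct h₁ (complexBetti.map π.hom.hom.hom (2 * p) c) u ∈ algebraicClasses (⨁ A).X (p + q) :=
    halg₁ (cupProduct_mem_weightClassesAlg h₁ hST hpc humem)
  have hz_alg : cupProduct hk (complexBetti.map π.hom.hom.hom (2 * p) c) y ∈ algebraicClasses (⨁ A).X (p + q + r) := by
    rw [hy, ← cupProduct_assoc h₁ rfl h₂ hk]
    exact AbelianVariety.cupProduct_mem_algebraicClasses' (⨁ A) h₂ hz₁ (halg₂ hηmem)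
  -- ## push forward along `π_e`
  set μ : OrientationFamily := complexOrientationFamily with hμdef
  have hμ : μ.HasPoincareDuality := OrientationFamily.hasPoincareDuality μ
  have hab : 2 * (p + q + r) + 2 * M' = 2 * p + 2 * M := by omega
  have hq' : (2 * q + 2 * r) + 2 * M' = 0 + 2 * M := by omega
  have hG_alg : complexGysin μ hX hX' π.hom.hom.hom hab
      (cupProduct hk (complexBetti.map π.hom.hom.hom (2 * p) c) y) ∈ algebraicClasses (⨁ fun j => A (e j)).X p :=
    complexGysin_mem_algebraicClasses (gysinMap_restrictCompl_eq_zero_of_field ℂ) μ hμ hX hX' π.hom.hom.hom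
      (q := p + q + r) (p := p) (by omega) hab hz_alg
  -- projection formula: `π_*(π^* c ∪ y) = c ∪ π_* y`, and `π_* y = ε • 1`
  rw [complexGysin_cup hμ hX hX' π.hom.hom.hom hk hab hq' (Nat.add_zero _) c y] at hG_alg
  obtain ⟨ε, hε⟩ := exists_eq_smul_one μ hX' (complexGysin μ hX hX' π.hom.hom.hom hq' y)
  rw [hε, map_smul, cupProduct_one] at hG_alg
  -- `ε ≠ 0`: test against the top class `π^* t ∪ y` of `X`
  have hε0 : ε ≠ 0 := by
    have hk₀ : 2 * M' + (2 * q + 2 * r) = 2 * M := hdim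
    have hab₀ : 2 * M + 2 * M' = 2 * M' + 2 * M := by ring
    have hz₀ : cupProduct hk₀ (complexBetti.map π.hom.hom.hom (2 * M') t) y ≠ 0 :=
      cupProduct_ne_zero_of_mem_weightClassesAlg hA hk₀ hUcard hTT'card hUTT' hpt hymem hpt0 hy0
    have hne := complexGysin_apply_top_ne_zero μ hX hX' π.hom.hom.hom hab₀ rfl hz₀
    rw [complexGysin_cup hμ hX hX' π.hom.hom.hom hk₀ hab₀ hq' (Nat.add_zero _) t y, hε, map_smul,
      cupProduct_one] at hne
    rintro rfl
    exact hne (zero_smul _ _)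
  -- ## conclusion: `c = ε⁻¹ • (ε • c)` is algebraic, and it spans the line
  rw [hlinec, Submodule.span_singleton_le_iff_mem]
  have h := Submodule.smul_mem _ ε⁻¹ hG_alg
  rwa [smul_smul, inv_mul_cancel₀ hε0, one_smul] at h

/-- **The same line read on the big product**: under the hypotheses of
`weightClassesAlg_le_algebraicClasses_of_pushforward`, the weight line of `σ_e S` on `X = ⨁_i A_i` is algebraic as well
(descend to `X'`, then pull back along `π_e`, `weightClassesAlg_map_le_algebraicClasses`).
[cite: Schoen1998HodgeWeilAddendum, §10] [cite: MoonenZarhin1999LowDim, Thm. 0.2 and (2.8)] -/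
theorem weightClassesAlg_map_le_algebraicClasses_of_pushforward
    (hA : ∀ i, IsCMTypeRealisation (Φ i) (A i) (ι i) (θ i)) (e : Fin m → Fin n) (he : Function.Injective e)
    {p q r : ℕ} {S : Finset ((j : Fin m) × (K (e j) →+* ℂ))} (hS : S.card = 2 * p)
    {T T' : Finset ((i : Fin n) × (K i →+* ℂ))} (hT : T.card = 2 * q) (hT' : T'.card = 2 * r)
    (hTT' : Disjoint T T') (hcov : ∀ x : (i : Fin n) × (K i →+* ℂ), (x ∈ T ∨ x ∈ T') ↔ x.1 ∉ Set.range e)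
    (halg₁ : weightClassesAlg A ι (2 * (p + q)) (S.map ⟨_, sigma_map_injective e he⟩ ∪ T) ≤
      algebraicClasses (⨁ A).X (p + q))
    (halg₂ : weightClassesAlg A ι (2 * r) T' ≤ algebraicClasses (⨁ A).X r) :
    weightClassesAlg A ι (2 * p) (S.map ⟨_, sigma_map_injective e he⟩) ≤ algebraicClasses (⨁ A).X p :=
  weightClassesAlg_map_le_algebraicClasses hA e he hS
    (weightClassesAlg_le_algebraicClasses_of_pushforward hA e he hS hT hT' hTT' hcov halg₁ halg₂)

end Summit.HodgeConjecture.CorCM.CMWeights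

end
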